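import Summits.QuantumAdvantage.QuantumAdvantage.Statement
import Summits.QuantumAdvantage.QuantumAdvantage.Theorems.SoloBlindLattice
import Literature.Computability.Complexity.Classes
import Literature.Computability.Complexity.CircuitClasses
import Literature.Computability.Complexity.Space
import Literature.Computability.Complexity.RelativizedTime
import Literature.Computability.Complexity.ProbabilisticClassesProofs
import Literature.Computability.QuantumComplexity.BQTime
import Literature.Computability.QuantumComplexity.ClassicalClassesProofs
import HarnessLib

/-!
# The classical FLOOR of the rungs of `QuantumAdvantage`

`SoloBlindLattice.lean` indexed the weakest open consequences of the summit
`QuantumAdvantage = ¬ (BQP ⊆ BPP)`: the fixed-polynomial rungs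
`R_k = ¬ (BQP ⊆ BPTIME(n^k))` (`soloBlind_fixedPoly_rung_iff : R_k ↔ Summit ∨ ¬ (BPP ⊆ BPTIME(n^k))`)
and the quasi-polynomial rung `S' = ¬ (BQTIME(quasipoly) ⊆ BPP)`
(`soloBlind_rung_iff_quantumHierarchy`). This file records, sorry-free, the logic of their FLOOR:
the negation of a rung is a *universal speed-up by randomness* of a whole deterministic class,
so EVERY classical separation of that class from a class containing bounded-error probabilistic
time of the relevant order already proves the rung — and the quantum computer enters none of them.

* `soloBlind_fixedPoly_rung_of_not_P_subset`: for every class `C ⊇ BPTIME(n^k)`,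
  `¬ (P ⊆ C) → R_k`; contrapositively `soloBlind_P_subset_of_not_fixedPoly_rung`: in the world
  `¬ R_k` one has `P ⊆ C`. Instances (the simulations enter as explicit hypotheses — the tree
  has no space-bounded simulation of `BPTime` and Adleman's theorem is the named fact
  `BPP_subset_PPoly`): `C = DSPACE(n^k)` (`BPTIME(t) ⊆ DSPACE(O(t))`: cycle through the coin
  strings), `C = SIZE s` (Adleman 1978: `BPTIME(t) ⊆ SIZE(Õ(t·n))`), so that
  "`P ⊄ DSPACE(n)`" (open since Book 1972) and "`P ⊄ SIZE(Õ(n²))`" (no superlinear circuit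
  lower bound for `P` is known) each imply `R_1 = "BQP ⊄ BPTIME(n)"`.
* `soloBlind_fixedPoly_rung_of_time_lower_bound` / `_of_E_lower_bound`: a single randomised
  time lower bound for a deterministic time class (rETH-type: `DTIME(T) ⊄ BPTIME(T')`,
  `E ⊄ C`) gives `R_k`, the downward padding `P ⊆ BPTIME(n^k) → DTIME(T) ⊆ BPTIME(T^{k/j})`
  entering as the hypothesis `hpad` (a machine construction not in the tree).
* `soloBlind_rung_of_not_QP_subset`: for every class `C ⊇ BPP`, a separation
  `DTIME(2^{(log n)^a}) ⊄ C` gives `S'`, modulo the classical-inside-quantum simulation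
  `DTIME(2^{(log n)^a}) ⊆ BQTIME(quasipoly)` (`hDQ`); with the tree's PROVED `BPP ⊆ PSPACE`
  this reads "`DTIME(quasipoly) ⊄ PSPACE → S'`" (`soloBlind_rung_of_not_QP_subset_PSPACE`), and with
  Adleman's named fact "`DTIME(quasipoly) ⊄ P/poly → S'`" (`soloBlind_rung_of_not_QP_subset_PPoly`).

Nothing here is progress towards the summit: each theorem is two or three inclusions composed.
The content is the INDEX — every hypothesis on the left is a classical open problem
(P versus DLBA: Book 1972, cf. Homer–Selman 2011 Thm. 5.19; superlinear circuit lower bounds: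
Arora–Barak 2009 §6.5; time versus space: Williams 2025; rETH: Dell–Husfeldt–Marx–Taslaman–Wahlén
2014, Chen–Rothblum–Tell–Yogev 2020), and a proof of a rung that genuinely uses quantum
computation must succeed in the world where all of them fail simultaneously.

References: R. V. Book, *On languages accepted in polynomial time*, SIAM J. Comput. 1 (1972);
S. Homer, A. Selman, *Computability and Complexity Theory*, 2nd ed. (2011), §5.7, Thm. 5.19;
L. Adleman, *Two theorems on random polynomial time*, FOCS 1978; S. Arora, B. Barak,
*Computational Complexity* (2009), Thm. 7.14, §6.5; R. Williams, *Simulating time with square-root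
space*, STOC 2025, Thm. 1.1; L. Chen, R. Rothblum, R. Tell, E. Yogev, *On exponential-time
hypotheses, derandomization, and circuit lower bounds*, FOCS 2020 / J. ACM 70 (2023), Hyp. 1,
Thms. 1.1–1.3.
-/

namespace Summit.QuantumAdvantage.QuantumAdvantage.Theorems

open Literature.Computability.Complexity Literature.Computability.Complexity.Classes
  Literature.Computability.Cryptography
  Literature.Computability.QuantumComplexity

/-! ### The floor of the fixed-polynomial rungs `R_k = ¬ (BQP ⊆ BPTIME(n^k))` -/

/-- **Generic floor of `R_k`.** If some class `C` contains `BPTIME(n^k)` but not `P`, then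
`BQP ⊄ BPTIME(n^k)`: otherwise `P ⊆ BPP ⊆ BQP ⊆ BPTIME(n^k) ⊆ C`. (Uses the tree's proved
`P ⊆ BPP` and, through `soloBlind_fixedPoly_rung_iff`, `BPP ⊆ BQP`.) -/
theorem soloBlind_fixedPoly_rung_of_not_P_subset (k : ℕ) {C : Set (Language Bool)}
    (hsim : BPTime (fun n => n ^ k) ⊆ C) (hsep : ¬ (P ⊆ C)) :
    ¬ (BQP ⊆ BPTime fun n => n ^ k) :=
  (soloBlind_fixedPoly_rung_iff k).2
    (Or.inr fun hB => hsep (P_subset_BPP_holds.trans (hB.trans hsim)))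

/-- **The uncovered world `¬ R_k`, read classically.** If `BQP ⊆ BPTIME(n^k)` then `P ⊆ C` for
every class `C ⊇ BPTIME(n^k)` — e.g. (with the standard simulations) `P ⊆ DSPACE(n^k)`,
`P ⊆ SIZE(Õ(n^{k+1}))`, `P ⊆ Σ₂TIME(Õ(n^{2k}))`. -/
theorem soloBlind_P_subset_of_not_fixedPoly_rung (k : ℕ) {C : Set (Language Bool)}
    (hsim : BPTime (fun n => n ^ k) ⊆ C) (hW : BQP ⊆ BPTime fun n => n ^ k) : P ⊆ C := by
  by_contra hsep
  exact soloBlind_fixedPoly_rung_of_not_P_subset k hsim hsep hW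

/-- **`P ⊄ DSPACE(n^k) → R_k`**, the space-bounded simulation `BPTIME(n^k) ⊆ DSPACE(n^k)`
(enumerate the `O(n^k)` coin strings reusing the work tape, count acceptances; Arora–Barak 2009,
Ex. 7.7) entering as the hypothesis `hspace`. At `k = 1`: "`P ⊄ DLBA`", one direction of the
question left open by Book's `DLBA ≠ P` (1972; Homer–Selman 2011, Thm. 5.19), implies
"`BQP ⊄ BPTIME(n)`". -/
theorem soloBlind_fixedPoly_rung_of_not_P_subset_DSPACE (k : ℕ)
    (hspace : BPTime (fun n => n ^ k) ⊆ DSPACE (fun n => n ^ k))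
    (hsep : ¬ (P ⊆ DSPACE fun n => n ^ k)) :
    ¬ (BQP ⊆ BPTime fun n => n ^ k) :=
  soloBlind_fixedPoly_rung_of_not_P_subset k hspace hsep

/-- **`P ⊄ SIZE(s) → R_k`** for any size bound `s` with `BPTIME(n^k) ⊆ SIZE(s)` — Adleman's
theorem gives `s = Õ(n^{k+1})` (amplify `O(n)`-fold, fix one coin string, oblivious simulation;
Arora–Barak 2009, Thm. 7.14), entering as the hypothesis `hAdleman`. At `k = 1`: a circuit lower
bound `P ⊄ SIZE(Õ(n²))` — none superlinear is known for any language in `P` (Arora–Barak 2009,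
§6.5) — implies "`BQP ⊄ BPTIME(n)`". -/
theorem soloBlind_fixedPoly_rung_of_not_P_subset_SIZE (k : ℕ) (s : ℕ → ℕ)
    (hAdleman : BPTime (fun n => n ^ k) ⊆ SIZE s) (hsep : ¬ (P ⊆ SIZE s)) :
    ¬ (BQP ⊆ BPTime fun n => n ^ k) :=
  soloBlind_fixedPoly_rung_of_not_P_subset k hAdleman hsep

/-- **rETH-type floor.** A single randomised time lower bound `DTIME(T) ⊄ BPTIME(T')` for a
deterministic time class gives `R_k`, granted the downward padding
`P ⊆ BPTIME(n^k) → DTIME(T) ⊆ BPTIME(T')` (hypothesis `hpad`; for nice superpolynomial `T` and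
`T' = T^{k/j}`, any `j`, this is the textbook padding argument: pad `L ∈ DTIME(T)` to length
`T^{1/j}`, land in `P ⊆ BPTIME(N^k)`, pull back). With `T = 2^{N^{1/4}}·poly` on padded 3-SAT and
`T' = 2^{εv}`: the randomised Exponential-Time Hypothesis implies every `R_k`
(Chen–Rothblum–Tell–Yogev 2020, Hypothesis 1). -/
theorem soloBlind_fixedPoly_rung_of_time_lower_bound (k : ℕ) {T T' : ℕ → ℕ}
    (hpad : P ⊆ BPTime (fun n => n ^ k) → DTIME T ⊆ BPTime T')
    (hlb : ¬ (DTIME T ⊆ BPTime T')) :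
    ¬ (BQP ⊆ BPTime fun n => n ^ k) :=
  soloBlind_fixedPoly_rung_of_not_P_subset k subset_rfl fun hP => hlb (hpad hP)

/-- **`E`-type floor** (Impagliazzo–Wigderson-shaped). If `P ⊆ BPTIME(n^k)` puts `E` inside a
class `C` (hypothesis `hpad`: by downward padding `E ⊆ ⋂_ε BPTIME(2^{εn})`, hence inside
`⋂_ε SIZE(2^{εn})` by Adleman, or inside `⋂_ε DSPACE(2^{εn})`), then `E ⊄ C` — e.g. the IW97
hypothesis "`E ⊄ SIZE(2^{εn})` for some `ε`" — gives `R_k`. -/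
theorem soloBlind_fixedPoly_rung_of_E_lower_bound (k : ℕ) {C : Set (Language Bool)}
    (hpad : P ⊆ BPTime (fun n => n ^ k) → E ⊆ C) (hlb : ¬ (E ⊆ C)) :
    ¬ (BQP ⊆ BPTime fun n => n ^ k) :=
  soloBlind_fixedPoly_rung_of_not_P_subset k subset_rfl fun hP => hlb (hpad hP)

/-! ### The floor of the quasi-polynomial rung `S' = ¬ (BQTIME(quasipoly) ⊆ BPP)` -/

/-- `BQQP = BQTIME(quasipoly)` (local notation, as in `SoloBlindRung.lean` / `SoloBlindLattice.lean`). -/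
local notation "BQQP" => (⋃ k : ℕ, BQTime (fun n : ℕ => 2 ^ Nat.log 2 n ^ k))

/-- **Generic floor of `S'`.** If some class `C ⊇ BPP` misses deterministic quasi-polynomial time
at one level `a`, then `BQTIME(quasipoly) ⊄ BPP` — granted `DTIME(2^{(log n)^a}) ⊆ BQTIME(quasipoly)`
(hypothesis `hDQ`: deterministic time inside quantum time at the same level, a reversible-simulation
construction not in the tree). Otherwise `DTIME(2^{(log n)^a}) ⊆ BQQP ⊆ BPP ⊆ C`. -/
theorem soloBlind_rung_of_not_QP_subset {C : Set (Language Bool)} (hC : BPP ⊆ C) {a : ℕ}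
    (hDQ : DTIME (fun n => 2 ^ Nat.log 2 n ^ a) ⊆ BQQP)
    (hsep : ¬ (DTIME (fun n => 2 ^ Nat.log 2 n ^ a) ⊆ C)) :
    ¬ (BQQP ⊆ BPP) :=
  fun h => hsep (hDQ.trans (h.trans hC))

/-- **`DTIME(quasipoly) ⊄ PSPACE → S'`** (the tree PROVES `BPP ⊆ PSPACE`,
`BPP_subset_PSPACE_holds`). The hypothesis `DTIME(2^{(log n)^a}) ⊄ PSPACE` is refuted by
`EXP = PSPACE` and implies `EXP ≠ PSPACE`; both it and `EXP = PSPACE` are open. -/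
theorem soloBlind_rung_of_not_QP_subset_PSPACE {a : ℕ}
    (hDQ : DTIME (fun n => 2 ^ Nat.log 2 n ^ a) ⊆ BQQP)
    (hsep : ¬ (DTIME (fun n => 2 ^ Nat.log 2 n ^ a) ⊆ PSPACE)) :
    ¬ (BQQP ⊆ BPP) :=
  soloBlind_rung_of_not_QP_subset BPP_subset_PSPACE_holds hDQ hsep

/-- **`DTIME(quasipoly) ⊄ P/poly → S'`**, with Adleman's theorem as the tree's named fact
`BPP_subset_PPoly` (Adleman 1978; Arora–Barak 2009, Thm. 7.14). No superpolynomial circuit lower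
bound for `EXP`, let alone for quasi-polynomial time, is known. -/
theorem soloBlind_rung_of_not_QP_subset_PPoly (hA : BPP_subset_PPoly) {a : ℕ}
    (hDQ : DTIME (fun n => 2 ^ Nat.log 2 n ^ a) ⊆ BQQP)
    (hsep : ¬ (DTIME (fun n => 2 ^ Nat.log 2 n ^ a) ⊆ PPoly)) :
    ¬ (BQQP ⊆ BPP) :=
  soloBlind_rung_of_not_QP_subset hA hDQ hsep

/-- **Summary disjunction for `R_1`** ("BQP is not inside probabilistic LINEAR time"): granted the
two textbook simulations of `BPTIME(n)` (space `n`; circuits of size `s`, Adleman), ANY ONE of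
`P ⊄ DSPACE(n)`, `P ⊄ SIZE(s)`, `P ⊄ BPTIME(n)`, or the summit proves it. -/
theorem soloBlind_linear_rung_floor (s : ℕ → ℕ)
    (hspace : BPTime (fun n => n ^ 1) ⊆ DSPACE (fun n => n ^ 1))
    (hAdleman : BPTime (fun n => n ^ 1) ⊆ SIZE s)
    (h : ¬ (P ⊆ DSPACE fun n => n ^ 1) ∨ ¬ (P ⊆ SIZE s) ∨ ¬ (P ⊆ BPTime fun n => n ^ 1) ∨
      _root_.QuantumAdvantage) :
    ¬ (BQP ⊆ BPTime fun n => n ^ 1) := by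
  rcases h with h | h | h | h
  · exact soloBlind_fixedPoly_rung_of_not_P_subset_DSPACE 1 hspace h
  · exact soloBlind_fixedPoly_rung_of_not_P_subset_SIZE 1 s hAdleman h
  · exact soloBlind_fixedPoly_rung_of_not_P_subset 1 subset_rfl h
  · exact soloBlind_fixedPoly_rung_of_summit h 1

end Summit.QuantumAdvantage.QuantumAdvantage.Theorems
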